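import Mathlib
import Summits.ResolutionOfSingularities.ResolutionOfSingularities.Theorems.HomologicalConductorPersistenceCyclicTransferAbelian
import HarnessLib

/-!
# Crux `Persistence` (stmt-16484) / rung S-2 `PersistenceSurface` (stmt-19970) — the finite-group transfer for an
# ABELIAN group through a BICHARACTER, and the orthogonality bookkeeping for `ℤ/d₁ × ⋯ × ℤ/d_r`
# (chain W4.4b, seat res-L1-w44b-stub-4 gen 5; T-V package part 9)

[OURS · L1 w44b · rung S-2] Nothing here is a statement of the manuscript under review (Hironaka 2017);
AI-written, weaker than expert review.  Continues part 8 (`…PersistenceCyclicTransferAbelian`,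
`exists_comp_eq_smul_id_fixed_of_isotypic_group`): the user-facing form for a finite ABELIAN group `G` whose dual
is realised as `X = G` through a `U`-valued BICHARACTER `χ : G → G → U` (multiplicative in both variables,
`χ 1 g = χ x 1 = 1`, orthogonality `∑_x χ x g = 0` for `g ≠ 1`, `|G| ∈ Uˣ`) — e.g. `G = ℤ/d₁ × ⋯ × ℤ/d_r` with
`χ x g = ∏ₗ ωₗ ^ (xₗ gₗ)` for primitive `dₗ`-th roots of unity `ωₗ` in a domain — and the two lemmas that build the
orthogonality hypothesis for such products from the cyclic case.

RESULTS.
* `exists_comp_eq_smul_id_fixed_of_bicharacter` — `c` of character `χ x_c`, `a ∈ 𝔞_{x_c}^G := ⋂_x V_[x] V_[(x x_c)⁻¹]`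
  (for every `x`, `a = ∑_k b_k b'_k`, `b_k` of character `χ x`, `b'_k` of character `χ (x x_c)⁻¹`), a free
  `V`-factorisation `π ∘ ι = c • id_M` ⟹ a free `U`-factorisation of `u • id_N` (`N = M^G`), `algebraMap u = a c`.
* `StablyAnnihilates.fixed_of_bicharacter` — CA-layer form.
* `sum_bicharacter_prod_eq_zero` — orthogonality passes to products `Ĝ₁ × Ĝ₂` on `G₁ × G₂`;
  `sum_pow_val_mul_val_eq_zero` — orthogonality for `Multiplicative (ZMod d)` with `χ x g = ω ^ (x.val g.val)` from
  `∑_{i<d} ω^{m i} = 0` (`d ∤ m`; e.g. `sum_pow_mul_eq_zero_of_isPrimitiveRoot`, part 1).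

USE (S-2, non-cyclic discriminant groups Z11 ℤ/3 × ℤ/6, Z13 ℤ/3 × ℤ/24, W13 ℤ/2 × ℤ/4 × ℤ/12): with `V` the UAC
Brieskorn–Pham / complete-intersection cover and `H = D(Γ)` acting diagonally, the floor
`∑_ψ 𝔞_ψ^H · (s̲ann_V)_[ψ] ⊆ s̲ann_{V^H}` holds in ONE step (no chain `1 ⊂ C ⊂ H`).

References: Iyengar–Takahashi, IMRN 2016, arXiv:1404.1476, Remark 2.13 [`IyengarTakahashi2014`]; character
orthogonality for finite abelian groups (folklore).
-/

-- single-problem summit: the doubled namespace component `ResolutionOfSingularities` is forced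
set_option linter.dupNamespace false

noncomputable section

open CategoryTheory Literature.RingTheory.CohomologyAnnihilator
open Summit.ResolutionOfSingularities.ResolutionOfSingularities.Theorems.NoZeno.SandwichCluster
open Summit.ResolutionOfSingularities.ResolutionOfSingularities.Theorems.HomologicalConductor.PersistenceSurfaceHullCover
open Summit.ResolutionOfSingularities.ResolutionOfSingularities.Theorems.HomologicalConductor.PersistenceCyclicTransfer
open Summit.ResolutionOfSingularities.ResolutionOfSingularities.Theorems.HomologicalConductor.PersistenceCyclicTransferFamily
open Summit.ResolutionOfSingularities.ResolutionOfSingularities.Theorems.HomologicalConductor.PersistenceCyclicTransferAbelian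

universe u

namespace Summit.ResolutionOfSingularities.ResolutionOfSingularities.Theorems.HomologicalConductor.PersistenceCyclicTransferAbelianBicharacter

variable {U V : Type u} [CommRing U] [CommRing V] [Algebra U V]
variable {M : Type u} [AddCommGroup M] [Module V M] [Module U M] [IsScalarTower U V M]
variable {N : Type u} [AddCommGroup N] [Module U N]
variable {G : Type*} [Group G]


/-! ## The abelian case through a bicharacter `χ : G → G → U` (`Ĝ ≅ G`) -/

/-- **Isotypic averaging lemma, bicharacter form** (`G` finite abelian, `X = G`, `χ` a `U`-valued BICHARACTER
— multiplicative in both variables, `χ 1 g = χ x 1 = 1` — with orthogonality `∑_x χ x g = 0` for `g ≠ 1` and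
`|G| ∈ Uˣ`; e.g. `G = ℤ/d₁ × ⋯ × ℤ/d_r`, `χ x g = ∏ ωₗ^{xₗ gₗ}` with primitive `dₗ`-th roots of unity `ωₗ` in a
domain, `sum_bicharacter_prod_eq_zero` + `sum_pow_mul_eq_zero_of_isPrimitiveRoot`).  `c` has character `χ x_c`
and for every `x`, `a = ∑_k b_k b'_k` with `b_k` of character `χ x` and `b'_k` of character `χ (x x_c)⁻¹`
— i.e. `a ∈ 𝔞_{x_c}^G := ⋂_x V_[x] V_[(x x_c)⁻¹]`; then `π ∘ ι = c • id_M` free over `V` gives a free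
`U`-factorisation of `u • id_N`, `algebraMap u = a c`. [folklore] -/
theorem exists_comp_eq_smul_id_fixed_of_bicharacter [Fintype G] (σ : G →* (V →ₐ[U] V))
    (hfix : ∀ v : V, (∀ g, σ g v = v) → ∃ u : U, algebraMap U V u = v)
    (hinj : Function.Injective (algebraMap U V)) (χ : G → G → U) (hχone₁ : ∀ g, χ 1 g = 1)
    (hχmul₁ : ∀ x x' g, χ (x * x') g = χ x g * χ x' g) (hχone₂ : ∀ x, χ x 1 = 1)
    (hχmul₂ : ∀ x g h, χ x (g * h) = χ x g * χ x h) (horth : ∀ g : G, g ≠ 1 → ∑ x, χ x g = 0)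
    (hGU : IsUnit ((Fintype.card G : ℕ) : U)) (τ : G → (M →+ M))
    (hτ : ∀ g (v : V) (m : M), τ g (v • m) = σ g v • τ g m) (hτmul : ∀ g h m, τ (g * h) m = τ g (τ h m))
    (hτone : ∀ m, τ 1 m = m) (j : N →ₗ[U] M) (hjinj : Function.Injective j) (hjτ : ∀ g n, τ g (j n) = j n)
    (hjsurj : ∀ m, (∀ g, τ g m = m) → ∃ n, j n = m) {c : V} (xc : G)
    (hc : ∀ g, σ g c = algebraMap U V (χ xc g) * c) {a : V}
    (ha : ∀ x : G, ∃ (n : ℕ) (b b' : Fin n → V), (∀ k g, σ g (b k) = algebraMap U V (χ x g) * b k) ∧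
      (∀ k g, σ g (b' k) = algebraMap U V (χ (x * xc)⁻¹ g) * b' k) ∧ ∑ k, b k * b' k = a)
    {s : ℕ} (ι : M →ₗ[V] (Fin s → V)) (π : (Fin s → V) →ₗ[V] M) (hπι : π ∘ₗ ι = c • LinearMap.id) (u : U)
    (hu : algebraMap U V u = a * c) :
    ∃ (t : ℕ) (f' : N →ₗ[U] (Fin t → U)) (g' : (Fin t → U) →ₗ[U] N), g' ∘ₗ f' = u • LinearMap.id := by
  refine exists_comp_eq_smul_id_fixed_of_isotypic_group σ hfix hinj χ hχone₂ hχmul₂ horth hGU hGU τ hτ hτmul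
    hτone j hjinj hjτ hjsurj (χ xc) hc (fun x => ?_) ι π hπι u hu
  obtain ⟨n, b, b', hb, hb', hab⟩ := ha x
  refine ⟨n, b, b', (x * xc)⁻¹, hb, hb', fun g => ?_, hab⟩
  rw [mul_assoc, ← hχmul₁ x xc g, ← hχmul₁, inv_mul_cancel, hχone₁]

/-! ## CA-layer form -/

/-- **Bicharacter form, CA layer**: `c` of character `χ x_c` stably annihilates `M` over `V`,
`a ∈ 𝔞_{x_c}^G = ⋂_x V_[x] V_[(x x_c)⁻¹]`, `algebraMap U V u = a * c` ⟹ `u` stably annihilates `N ≅ M^G`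
over `U = V^G`. [folklore] -/
theorem StablyAnnihilates.fixed_of_bicharacter [Fintype G] (σ : G →* (V →ₐ[U] V))
    (hfix : ∀ v : V, (∀ g, σ g v = v) → ∃ u : U, algebraMap U V u = v)
    (hinj : Function.Injective (algebraMap U V)) (χ : G → G → U) (hχone₁ : ∀ g, χ 1 g = 1)
    (hχmul₁ : ∀ x x' g, χ (x * x') g = χ x g * χ x' g) (hχone₂ : ∀ x, χ x 1 = 1)
    (hχmul₂ : ∀ x g h, χ x (g * h) = χ x g * χ x h) (horth : ∀ g : G, g ≠ 1 → ∑ x, χ x g = 0)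
    (hGU : IsUnit ((Fintype.card G : ℕ) : U)) (τ : G → (M →+ M))
    (hτ : ∀ g (v : V) (m : M), τ g (v • m) = σ g v • τ g m) (hτmul : ∀ g h m, τ (g * h) m = τ g (τ h m))
    (hτone : ∀ m, τ 1 m = m) (j : N →ₗ[U] M) (hjinj : Function.Injective j) (hjτ : ∀ g n, τ g (j n) = j n)
    (hjsurj : ∀ m, (∀ g, τ g m = m) → ∃ n, j n = m) {c : V} (xc : G)
    (hc : ∀ g, σ g c = algebraMap U V (χ xc g) * c) {a : V}
    (ha : ∀ x : G, ∃ (n : ℕ) (b b' : Fin n → V), (∀ k g, σ g (b k) = algebraMap U V (χ x g) * b k) ∧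
      (∀ k g, σ g (b' k) = algebraMap U V (χ (x * xc)⁻¹ g) * b' k) ∧ ∑ k, b k * b' k = a)
    (h : StablyAnnihilates V c (ModuleCat.of V M)) (u : U) (hu : algebraMap U V u = a * c) :
    StablyAnnihilates U u (ModuleCat.of U N) := by
  obtain ⟨s, ι, π, hπι⟩ := (stablyAnnihilates_iff_exists_linearMap c (ModuleCat.of V M)).mp h
  obtain ⟨t, f', g', h'⟩ := exists_comp_eq_smul_id_fixed_of_bicharacter σ hfix hinj χ hχone₁ hχmul₁ hχone₂
    hχmul₂ horth hGU τ hτ hτmul hτone j hjinj hjτ hjsurj xc hc ha ι π hπι u hu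
  exact stablyAnnihilates_of_linearMap f' g' h'

/-! ## Orthogonality is inherited by products of groups -/

/-- Orthogonality for a product: if `∑_{x₁} χ₁ x₁ g₁ = 0` for `g₁ ≠ 1` and `∑_{x₂} χ₂ x₂ g₂ = 0` for `g₂ ≠ 1`, then
the product characters `(x₁,x₂) ↦ (g ↦ χ₁ x₁ g.1 * χ₂ x₂ g.2)` satisfy `∑_{x} = 0` for `g ≠ 1` — the step
`Ĝ₁ × Ĝ₂ = (G₁ × G₂)^` that assembles `ℤ/d₁ × ⋯ × ℤ/d_r` from the cyclic case. [folklore] -/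
theorem sum_bicharacter_prod_eq_zero {R : Type*} [CommRing R] {G₁ G₂ X₁ X₂ : Type*} [Group G₁] [Group G₂]
    [Fintype X₁] [Fintype X₂] (χ₁ : X₁ → G₁ → R) (χ₂ : X₂ → G₂ → R)
    (h₁ : ∀ g : G₁, g ≠ 1 → ∑ x, χ₁ x g = 0) (h₂ : ∀ g : G₂, g ≠ 1 → ∑ x, χ₂ x g = 0) (g : G₁ × G₂)
    (hg : g ≠ 1) : ∑ x : X₁ × X₂, χ₁ x.1 g.1 * χ₂ x.2 g.2 = 0 := by
  have hprod : ∑ x : X₁ × X₂, χ₁ x.1 g.1 * χ₂ x.2 g.2 = (∑ x₁, χ₁ x₁ g.1) * ∑ x₂, χ₂ x₂ g.2 := by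
    rw [Fintype.sum_prod_type, Finset.sum_mul_sum]
  rw [hprod]
  by_cases hg₁ : g.1 = 1
  · have hg₂ : g.2 ≠ 1 := fun hg₂ => hg (Prod.ext hg₁ hg₂)
    rw [h₂ _ hg₂, mul_zero]
  · rw [h₁ _ hg₁, zero_mul]

/-- Orthogonality for the cyclic group `Multiplicative (ZMod d)` with the characters `x ↦ (g ↦ ω ^ (x.val * g.val))`
of a `d`-th root of unity `ω` satisfying `∑_{i<d} ω^{m i} = 0` for `d ∤ m` (e.g. a primitive root in a domain,
`sum_pow_mul_eq_zero_of_isPrimitiveRoot`): `∑_x ω^{x.val g.val} = 0` for `g ≠ 1`. [folklore] -/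
theorem sum_pow_val_mul_val_eq_zero {R : Type*} [CommRing R] {d : ℕ} [NeZero d] {ω : R}
    (horth : ∀ m : ℕ, ¬ d ∣ m → ∑ i ∈ Finset.range d, ω ^ (m * i) = 0) (g : Multiplicative (ZMod d))
    (hg : g ≠ 1) :
    ∑ x : Multiplicative (ZMod d), ω ^ ((Multiplicative.toAdd x).val * (Multiplicative.toAdd g).val) = 0 := by
  obtain ⟨n, rfl⟩ : ∃ n, d = n + 1 := ⟨d - 1, (Nat.succ_pred_eq_of_ne_zero (NeZero.ne d)).symm⟩
  set m := (Multiplicative.toAdd g).val with hm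
  have hg' : Multiplicative.toAdd g ≠ 0 := fun h => hg (toAdd_eq_zero.mp h)
  have hm0 : m ≠ 0 := fun h => hg' ((ZMod.val_eq_zero _).mp h)
  have hnd : ¬ (n + 1) ∣ m := fun h => hm0 (Nat.eq_zero_of_dvd_of_lt h (ZMod.val_lt _))
  rw [← horth m hnd, ← Equiv.sum_comp Multiplicative.ofAdd]
  simp only [toAdd_ofAdd]
  rw [← Fin.sum_univ_eq_sum_range (fun i => ω ^ (m * i)) (n + 1)]
  exact Finset.sum_congr rfl fun i _ => by rw [mul_comm]; rfl

end Summit.ResolutionOfSingularities.ResolutionOfSingularities.Theorems.HomologicalConductor.PersistenceCyclicTransferAbelianBicharacter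

end
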